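import Mathlib
import Literature.Computability.AlgebraicComplexity.PermanentIrreducible
import Literature.Computability.AlgebraicComplexity.StandardFamiliesProofs
import Summits.ValiantsHypothesis.ValiantsHypothesis.Theorems.DivisionGapPerCofactorDegreeReductionStubRelationComponents
import Summits.ValiantsHypothesis.ValiantsHypothesis.Theorems.DivisionGapPerCofactorDegreeReductionStubWeightedLineNormalForm
import Summits.ValiantsHypothesis.ValiantsHypothesis.Theorems.DivisionGapPerCofactorDegreeReductionStubBinaryFormCollapse
import Summits.ValiantsHypothesis.ValiantsHypothesis.Theorems.DivisionGapPerCofactorDegreeReductionStubAdditiveCreation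
import Summits.ValiantsHypothesis.ValiantsHypothesis.Theorems.ChowBorderDepth3LocalFanInTwo

/-!
# Crux `DivisionGap.PerCofactorDegreeReduction` (stmt-ValiantsHypothesis-15046), line `Sketch` —
# stub `stub_twoClassCollapse`: every nonnegative relation between two homogeneous light gates is
# carried by the primitive antipodal pair

**Theorem (`stub_twoClassCollapse`).** Let `n ≥ 1`, let `u, u' ∈ ℝ≥0[x_ij]` (`n × n` variables) be
forms of degrees `e, e' ≥ 1`, neither divisible by `per_n` over `ℝ`, and let `G ∈ ℝ≥0[z₀, z₁]` be
nonzero with `per_n ∣ G(u, u')` over `ℝ`.  Put `g = gcd(e, e')`, `p = e'/g`, `q = e/g`.  Then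
`per_n ∣ u^p + γ u'^q` over `ℝ` for some real `γ > 0`.

## Proof

* §1 *A nonzero weighted component which is again a relation.*  Pick `m₀ ∈ supp G` and let `D` be
  its weight for the weights `(e, e')`; the weighted component `G_D` (taken over `ℝ≥0`) is nonzero
  (`coeff_weightedHomogeneousComponent`) and weighted homogeneous.  Substituting the forms `u, u'`
  is graded (`RelationComponents.homogeneousComponent_aeval`): `G_D(u, u')` is the degree-`D`
  homogeneous component of `G(u, u')`; base change to `ℝ` commutes with homogeneous components
  (`ChowBorderDepth3LocalFanInTwo.map_homogeneousComponent`), and the form `per_n` divides every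
  homogeneous component of its multiples (`RelationComponents.dvd_homogeneousComponent_mul`).  So
  `per_n ∣ G_D(u, u')` over `ℝ`.
* §2 *Normal form.*  `G_D = z₀^{a₀} z₁^{b₀} · Σᵢ cᵢ (z₀^p)ⁱ (z₁^q)^{N-i}` with `cᵢ ≥ 0`, `c₀ ≠ 0`
  (`WeightedLineNormalForm.stub_weightedLineNormalForm` over `ℝ≥0`), hence
  `G_D(u, u') = u^{a₀} u'^{b₀} · Σᵢ cᵢ (u^p)ⁱ (u'^q)^{N-i}`.
* §3 *Cancel the monomial.*  `per_n` is prime over `ℝ` (`AdditiveCreation.perPoly_prime`) and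
  divides neither `u` nor `u'`, hence none of their powers; so it divides the binary form
  `Σᵢ cᵢ (u^p)ⁱ (u'^q)^{N-i}` over `ℝ`.
* §4 *Collapse.*  `BinaryFormCollapse.stub_binaryFormCollapse` applied to the pair `(u^p, u'^q)`
  gives `γ > 0` with `per_n ∣ u^p + γ u'^q` over `ℝ`.
-/

noncomputable section

-- `Summit.ValiantsHypothesis.ValiantsHypothesis.…` is the tree's mandated single-conjunct layout
-- (Problem = Summit), so the duplicated namespace component is intended.
set_option linter.dupNamespace false

namespace Summit.ValiantsHypothesis.ValiantsHypothesis.Theorems.DivisionGap.PerCofactorDegreeReduction.TwoClassCollapse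

open MvPolynomial Literature.Computability.AlgebraicComplexity
open Summit.ValiantsHypothesis.ValiantsHypothesis.Theorems.DivisionGap.PerCofactorDegreeReduction.RelationComponents
  (homogeneousComponent_aeval dvd_homogeneousComponent_mul)
open Summit.ValiantsHypothesis.ValiantsHypothesis.Theorems.DivisionGap.PerCofactorDegreeReduction.WeightedLineNormalForm
  (stub_weightedLineNormalForm)
open Summit.ValiantsHypothesis.ValiantsHypothesis.Theorems.DivisionGap.PerCofactorDegreeReduction.BinaryFormCollapse
  (stub_binaryFormCollapse)
open Summit.ValiantsHypothesis.ValiantsHypothesis.Theorems.DivisionGap.PerCofactorDegreeReduction.AdditiveCreation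
  (perPoly_prime)
open Summit.ValiantsHypothesis.ValiantsHypothesis.Theorems.ChowBorderDepth3LocalFanInTwo
  (map_homogeneousComponent)
open scoped NNReal BigOperators

/-! ### The stub -/

/-- **stub_twoClassCollapse — EVERY NONNEGATIVE RELATION BETWEEN TWO HOMOGENEOUS LIGHT GATES IS THE
PRIMITIVE ANTIPODAL PAIR.**  `u, u' ≥ 0` homogeneous of degrees `e, e' ≥ 1`, not in `(per_n)`
(`n ≥ 1`); if a nonzero NONNEGATIVE `G ∈ ℝ≥0[z₀,z₁]` has `per_n ∣ G(u,u')` over `ℝ` then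
`per_n ∣ u^p + γ u'^q` over `ℝ` for some `γ > 0` (`p = e'/gcd(e,e')`, `q = e/gcd(e,e')`).  Proof: a
nonzero weighted component `G_D` of `G` is again a relation (substitution of forms is graded, the
form `per_n` divides the homogeneous components of its multiples); its normal form is a monomial
`z₀^{a₀} z₁^{b₀}` times a nonnegative binary form in `z₀^p, z₁^q` with a nonzero coefficient; the
prime `per_n` divides no power of `u, u'`, hence divides the binary form in `u^p, u'^q`, and
`stub_binaryFormCollapse` yields the antipodal pair. [folklore] -/
theorem stub_twoClassCollapse (n e e' : ℕ) (hn : 1 ≤ n) (he : 1 ≤ e) (he' : 1 ≤ e')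
    (u u' : MvPolynomial (Fin n × Fin n) ℝ≥0)
    (huh : u.IsHomogeneous e) (hu'h : u'.IsHomogeneous e')
    (hu : ¬ perPoly (Fin n) ℝ ∣ MvPolynomial.map NNReal.toRealHom u)
    (hu' : ¬ perPoly (Fin n) ℝ ∣ MvPolynomial.map NNReal.toRealHom u')
    (G : MvPolynomial (Fin 2) ℝ≥0) (hG : G ≠ 0)
    (hdvd : perPoly (Fin n) ℝ ∣ MvPolynomial.map NNReal.toRealHom (MvPolynomial.aeval ![u, u'] G)) :
    ∃ γ : ℝ≥0, 0 < γ ∧ perPoly (Fin n) ℝ ∣ MvPolynomial.map NNReal.toRealHom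
      (u ^ (e' / Nat.gcd e e') + γ • u' ^ (e / Nat.gcd e e')) := by
  classical
  -- §0 Primality and homogeneity bookkeeping.
  have hprime : Prime (perPoly (Fin n) ℝ) := perPoly_prime hn
  have hper : (perPoly (Fin n) ℝ).IsHomogeneous n := by
    simpa using (perPoly_isHomogeneous (n := Fin n) (k := ℝ))
  have hf : ∀ i, ((![u, u'] : Fin 2 → MvPolynomial (Fin n × Fin n) ℝ≥0) i).IsHomogeneous
      ((![e, e'] : Fin 2 → ℕ) i) := by
    intro i
    fin_cases i
    · simpa using huh
    · simpa using hu'h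
  -- §1 A nonzero weighted component of `G`, again a relation.
  obtain ⟨m₀, hm₀⟩ := support_nonempty.mpr hG
  obtain ⟨D, hD⟩ : ∃ D, Finsupp.weight (![e, e'] : Fin 2 → ℕ) m₀ = D := ⟨_, rfl⟩
  have hGD0 : weightedHomogeneousComponent (![e, e'] : Fin 2 → ℕ) D G ≠ 0 := by
    intro h
    apply mem_support_iff.mp hm₀
    have h0 := congr_arg (coeff m₀) h
    rwa [coeff_weightedHomogeneousComponent, if_pos hD, coeff_zero] at h0
  have hdvdD : perPoly (Fin n) ℝ ∣ MvPolynomial.map NNReal.toRealHom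
      (aeval ![u, u'] (weightedHomogeneousComponent (![e, e'] : Fin 2 → ℕ) D G)) := by
    rw [← homogeneousComponent_aeval _ hf, map_homogeneousComponent]
    obtain ⟨Q, hQ⟩ := hdvd
    rw [hQ]
    exact dvd_homogeneousComponent_mul hper Q D
  -- §2 Normal form of the component: a monomial times a binary form in `z₀^p, z₁^q`.
  obtain ⟨a₀, b₀, N, c, hc0, hGD⟩ := stub_weightedLineNormalForm e e' D he he' _ hGD0
    (weightedHomogeneousComponent_isWeightedHomogeneous D G)
  have hT : aeval ![u, u'] (weightedHomogeneousComponent (![e, e'] : Fin 2 → ℕ) D G) =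
      u ^ a₀ * u' ^ b₀ * ∑ i : Fin (N + 1), c i • ((u ^ (e' / Nat.gcd e e')) ^ (i : ℕ) *
        (u' ^ (e / Nat.gcd e e')) ^ (N - (i : ℕ))) := by
    rw [hGD]
    simp only [map_mul, map_pow, map_sum, aeval_X, aeval_C, algebraMap_eq, smul_eq_C_mul,
      Matrix.cons_val_zero, Matrix.cons_val_one, Matrix.cons_val_fin_one]
  -- §3 Over `ℝ`: the prime `per_n` divides no power of `u, u'`, hence divides the binary form.
  rw [hT] at hdvdD
  simp only [map_mul, map_pow] at hdvdD
  have hsum : perPoly (Fin n) ℝ ∣ MvPolynomial.map NNReal.toRealHom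
      (∑ i : Fin (N + 1), c i • ((u ^ (e' / Nat.gcd e e')) ^ (i : ℕ) *
        (u' ^ (e / Nat.gcd e e')) ^ (N - (i : ℕ)))) := by
    rcases hprime.dvd_or_dvd hdvdD with h | h
    · rcases hprime.dvd_or_dvd h with h | h
      · exact absurd (hprime.dvd_of_dvd_pow h) hu
      · exact absurd (hprime.dvd_of_dvd_pow h) hu'
    · exact h
  -- §4 Collapse of the binary form in the powers `u^p, u'^q`.
  have hc : c ≠ 0 := fun h => hc0 (by rw [h]; rfl)
  have hup : ¬ perPoly (Fin n) ℝ ∣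
      MvPolynomial.map NNReal.toRealHom (u ^ (e' / Nat.gcd e e')) :=
    fun h => hu (hprime.dvd_of_dvd_pow (by rwa [map_pow] at h))
  have hu'q : ¬ perPoly (Fin n) ℝ ∣
      MvPolynomial.map NNReal.toRealHom (u' ^ (e / Nat.gcd e e')) :=
    fun h => hu' (hprime.dvd_of_dvd_pow (by rwa [map_pow] at h))
  exact stub_binaryFormCollapse n N hn _ _ hup hu'q c hc hsum

end Summit.ValiantsHypothesis.ValiantsHypothesis.Theorems.DivisionGap.PerCofactorDegreeReduction.TwoClassCollapse

end
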